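import Literature.Barriers.CriticalPhenomena.LaceExpansionSAWIdentity
import Mathlib.Data.Finset.Sort
import Mathlib.Algebra.Group.Pi.Lemmas
import HarnessLib

/-!
# Graham's Borel-type bound for `z_c(d)` (BDGS 2012, (1.20)), II: the number of lace graphs of
# length `a` and type `N` in `ℤ^d` is a polynomial in the dimension (Graham 2010, §3)

Sibling file of `Literature.Probability.RandomPlanarGeometry.BDGS2012` (fact
`BDGS2012_Graham_criticalPoint_bound` = Graham 2010, Theorem 1), sequel to
`BDGS2012GrahamReversion.lean`. Graham's expansion coefficients `c_{a,b,N}` are defined by writing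
"the number of memory-`τ` lace graphs of length `a` and type `N` in `ℤ^d` as a polynomial in
powers of `s⁻¹ = 2d`" (§3, the display before (cab)): `Σ_{D=1}^{⌊a/2⌋} f_τ(a,N,D)·2d(2d-2)⋯(2d-2D+2)
= Σ_{b=⌈a/2⌉}^{a-1} c_{a,b,N} s^{b-a}`, where `f_τ(a,N,D)` "count[s] the number of equivalence
classes of memory-`τ` lace graphs in `ℤ^D` with length `a`, type `N` and dimensionality `D`" and
"lace graphs with dimensionality `D` have length at least `2D`". This file proves that structure
for the tree's lace graphs — the first-hitting-time diagrams `SAWLace.piN d a M x = π_a^{(M+1)}(x)`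
of `Literature/Barriers/CriticalPhenomena/LaceExpansionSAWIdentity.lean` (Slade 2006, §3.1), at
infinite memory — in the cleaner labelled form: the walks of `ℤ^d` using EXACTLY the coordinate
set `S`, `|S| = D`, are in bijection with the walks of `ℤ^D` using all `D` coordinates (relabel the
coordinates along the increasing enumeration of `S`), so that a coordinate-symmetric count equals
`Σ_D C(d,D)·g(D)` with `g(D)` the count in `ℤ^D` of walks using every coordinate — a polynomial
in `d` with `d`-independent coefficients — and `g(D) = 0` unless `2D ≤ a` for lace graphs, every
step of a lace graph lying on a closed subwalk.

## What is formalised (namespace `Literature.Probability.RandomPlanarGeometry.SAW.Zd.Graham2010`)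

* `linEmbed ι : Site D →+ Site d` (= Mathlib's `Function.ExtendByZero.hom ℤ ι`, i.e.
  `Function.extend ι · 0`, with its API taken from `Function.Injective.extend_apply`,
  `Function.extend_apply'`, `Function.extend_injective`) and `relabel ι : StepSeq D n → StepSeq d n`
  for an injection `ι : Fin D ↪ Fin d` of coordinates, `pos_relabel` (`ω ↦ ι ∘ ω` on positions),
  and the invariance of the lace data of §3.1 under relabelling: `lacePair_relabel`,
  `isDiag_relabel_iff`;
* `usedDirs σ` (the set of coordinates in which `σ` steps), `usedDirs_relabel`;
* **`card_filter_eq_sum_choose_mul`** — for every relabelling-invariant property `P` of `n`-step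
  walks, `#{σ : StepSeq d n | P σ} = Σ_{D=0}^{n} C(d,D) · dimCount n P D`, where
  `dimCount n P D = #{τ : StepSeq D n | P τ ∧ usedDirs τ = univ}` does not depend on `d`;
* the lace graphs: `diagTotal d a M = Σ_x π_a^{(M+1)}(x) = #{σ : StepSeq d a | IsDiag σ M ∧ T_M = a}`
  (`diagTotal_eq_sum_piN`), `diagDim a M D` (= Graham's `f(a, M+1, D)` up to the labelling of
  the symmetry classes), **`diagTotal_eq_sum_choose_mul`**
  (`diagTotal d a M = Σ_{D=0}^{a} C(d,D) · diagDim a M D`), the support facts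
  `diagDim_eq_zero_of_lt` ("dimensionality `D` needs length `≥ 2D`": `diagDim a M D = 0` if
  `a < 2D`) and `diagDim_le` (`diagDim a M D ≤ (2D)^a`), and `diagTotal_eq_sum_Icc`
  (`diagTotal d a M = Σ_{D=1}^{⌊a/2⌋} C(d,D) · diagDim a M D` for `a ≥ 1`).

Since `diagDim` counts LABELLED walks using all `D` coordinates (Graham's `f_τ(a,N,D)` counts
their classes under the hyperoctahedral symmetries), the symmetry factor `2d(2d-2)⋯(2d-2D+2)` of the
source is replaced by `C(d,D) = 2d(2d-2)⋯(2d-2D+2)/(2^D D!)`; the sequel's Lemma 4 bound goes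
through `diagDim_le` (`≤ (2D)^a`, all walks of `ℤ^D`) instead of the printed
`Σ_N f_τ(a,N,D) ≤ (2D)^a/(2^D D!)` — the same estimate up to where the factor `2^D D!` is booked.

Not here: the passage to powers of `2d` and the bound on the coefficients `c_{a,b}` (Lemma 4),
which is the sequel `BDGS2012GrahamLemma4.lean`.
-/

noncomputable section

open Finset
open Literature.Probability.LatticeModels Literature.Probability.LatticeModels.SRW
open Literature.Barriers.CriticalPhenomena.SAWLace
open scoped BigOperators

namespace Literature.Probability.RandomPlanarGeometry.SAW.Zd.Graham2010

/-! ### Relabelling the coordinates -/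

section Relabel

variable {d D : ℕ}

/-- The linear embedding `ℤ^D → ℤ^d` along an injection `ι` of coordinates:
`(linEmbed ι y)_{ι k} = y_k`, all other coordinates `0`. This is Mathlib's bundled
`Function.ExtendByZero.hom ℤ ι` (`Function.extend ι y 0`), named here for readability; its three
API lemmas below are Mathlib's `Function.Injective.extend_apply`, `Function.extend_apply'` and
`Function.extend_injective`. [folklore] -/
def linEmbed (ι : Fin D ↪ Fin d) : Site D →+ Site d :=
  Function.ExtendByZero.hom ℤ ι

/-- `(linEmbed ι y)_{ι k} = y_k` (`Function.Injective.extend_apply`). [folklore] -/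
theorem linEmbed_apply_self (ι : Fin D ↪ Fin d) (y : Site D) (k : Fin D) :
    linEmbed ι y (ι k) = y k := by
  rw [linEmbed, Function.ExtendByZero.hom_apply, ι.injective.extend_apply]

/-- `(linEmbed ι y)_j = 0` off the range of `ι` (`Function.extend_apply'`). [folklore] -/
theorem linEmbed_apply_of_forall_ne (ι : Fin D ↪ Fin d) (y : Site D) {j : Fin d}
    (hj : ∀ k, ι k ≠ j) : linEmbed ι y j = 0 := by
  rw [linEmbed, Function.ExtendByZero.hom_apply, Function.extend_apply' _ _ _ fun ⟨k, hk⟩ => hj k hk]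
  rfl

/-- `linEmbed ι` is injective (`Function.extend_injective`). [folklore] -/
theorem linEmbed_injective (ι : Fin D ↪ Fin d) : Function.Injective (linEmbed ι) := by
  intro y y' h
  refine Function.extend_injective ι.injective (0 : Fin d → ℤ) ?_
  change Function.extend ι y 0 = Function.extend ι y' 0
  have h' : ∀ j, linEmbed ι y j = linEmbed ι y' j := fun j => by rw [h]
  funext j
  simpa [linEmbed, Function.ExtendByZero.hom_apply] using h' j

/-- `linEmbed ι eₖ = e_{ι k}`. [folklore] -/
theorem linEmbed_single (ι : Fin D ↪ Fin d) (k : Fin D) (c : ℤ) :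
    linEmbed ι (Pi.single k c) = Pi.single (ι k) c := by
  funext j
  by_cases hj : ∃ k', ι k' = j
  · obtain ⟨k', rfl⟩ := hj
    rw [linEmbed_apply_self]
    by_cases hk : k' = k
    · subst hk; simp
    · rw [Pi.single_eq_of_ne hk, Pi.single_eq_of_ne]
      exact fun h => hk (ι.injective h)
  · have hj' : ∀ k', ι k' ≠ j := fun k' h => hj ⟨k', h⟩
    rw [linEmbed_apply_of_forall_ne ι _ hj', Pi.single_eq_of_ne]
    exact fun h => hj' k h.symm

/-- `linEmbed ι` carries the unit steps of `ℤ^D` to unit steps of `ℤ^d`: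
`linEmbed ι (±e_k) = ±e_{ι k}`. [folklore] -/
theorem linEmbed_stepVec (ι : Fin D ↪ Fin d) (v : Dir D) :
    linEmbed ι (stepVec v) = stepVec ((ι v.1, v.2) : Dir d) := by
  unfold stepVec
  rcases v with ⟨k, b⟩
  cases b
  · simp only [Bool.false_eq_true, ↓reduceIte, map_neg, linEmbed_single]
  · simp only [↓reduceIte, linEmbed_single]

/-- Relabel the coordinates of a step sequence along `ι`. [folklore] -/
def relabel (ι : Fin D ↪ Fin d) {n : ℕ} (σ : StepSeq D n) : StepSeq d n :=
  fun i => (ι (σ i).1, (σ i).2)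

/-- Positions of the relabelled walk: `(relabel ι σ)(t) = linEmbed ι (σ(t))`. [folklore] -/
theorem pos_relabel (ι : Fin D ↪ Fin d) {n : ℕ} (σ : StepSeq D n) (t : ℕ) :
    pos (relabel ι σ) t = linEmbed ι (pos σ t) := by
  unfold pos
  rw [map_sum]
  refine Finset.sum_congr rfl fun i _ => ?_
  split_ifs
  · rw [linEmbed_stepVec]; rfl
  · simp

/-- Relabelling is injective on step sequences. [folklore] -/
theorem relabel_injective (ι : Fin D ↪ Fin d) (n : ℕ) :
    Function.Injective (relabel ι (n := n)) := by
  intro σ σ' h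
  funext i
  have hi := congrFun h i
  simp only [relabel, Prod.mk.injEq] at hi
  exact Prod.ext (ι.injective hi.1) hi.2

/-- First hitting times only depend on the hitting predicate (two walks in possibly different
dimensions). [folklore] -/
theorem firstHit_congr_pred₂ {n : ℕ} {σ : StepSeq D n} {σ' : StepSeq d n} {S : Set (Site D)}
    {S' : Set (Site d)} (h : ∀ t, (pos σ' t ∈ S' ↔ pos σ t ∈ S)) (t₀ : ℕ) :
    firstHit σ' t₀ S' = firstHit σ t₀ S := by
  classical
  unfold firstHit
  simp only [h]

/-- The lace data of §3.1 are invariant under relabelling of the coordinates (they depend on the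
walk only through the coincidences `ω(s) = ω(t)`). [folklore] -/
theorem lacePair_relabel (ι : Fin D ↪ Fin d) {n : ℕ} (σ : StepSeq D n) (i : ℕ) :
    lacePair (relabel ι σ) i = lacePair σ i := by
  induction i with
  | zero => rfl
  | succ i ih =>
    change ((lacePair (relabel ι σ) i).2, firstHit (relabel ι σ) (lacePair (relabel ι σ) i).2
        (pos (relabel ι σ) '' Set.Icc (lacePair (relabel ι σ) i).1 (lacePair (relabel ι σ) i).2)) =
      ((lacePair σ i).2, firstHit σ (lacePair σ i).2 (pos σ '' Set.Icc (lacePair σ i).1 (lacePair σ i).2))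
    rw [ih]
    refine Prod.ext rfl ?_
    change firstHit (relabel ι σ) (lacePair σ i).2
        (pos (relabel ι σ) '' Set.Icc (lacePair σ i).1 (lacePair σ i).2) =
      firstHit σ (lacePair σ i).2 (pos σ '' Set.Icc (lacePair σ i).1 (lacePair σ i).2)
    refine firstHit_congr_pred₂ (fun t => ?_) _
    simp only [pos_relabel, Set.mem_image]
    constructor
    · rintro ⟨u, hu, he⟩; exact ⟨u, hu, linEmbed_injective ι he⟩
    · rintro ⟨u, hu, he⟩; exact ⟨u, hu, by rw [he]⟩

/-- `T_i` is invariant under relabelling. [folklore] -/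
theorem laceTime_relabel (ι : Fin D ↪ Fin d) {n : ℕ} (σ : StepSeq D n) (i : ℕ) :
    laceTime (relabel ι σ) i = laceTime σ i :=
  congrArg Prod.snd (lacePair_relabel ι σ (i + 1))

/-- `laceStart` is invariant under relabelling. [folklore] -/
theorem laceStart_relabel (ι : Fin D ↪ Fin d) {n : ℕ} (σ : StepSeq D n) (i : ℕ) :
    laceStart (relabel ι σ) i = laceStart σ i :=
  congrArg Prod.snd (lacePair_relabel ι σ i)

/-- Self-avoidance on a set of times is invariant under relabelling. [folklore] -/
theorem injOn_pos_relabel_iff (ι : Fin D ↪ Fin d) {n : ℕ} (σ : StepSeq D n) (S : Set ℕ) :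
    Set.InjOn (pos (relabel ι σ)) S ↔ Set.InjOn (pos σ) S := by
  simp only [Set.InjOn, pos_relabel, (linEmbed_injective ι).eq_iff]

/-- `IsDiag` (being a lace graph of order `M + 1`) is invariant under relabelling. [folklore] -/
theorem isDiag_relabel_iff (ι : Fin D ↪ Fin d) {n : ℕ} (σ : StepSeq D n) (M : ℕ) :
    IsDiag (relabel ι σ) M ↔ IsDiag σ M := by
  simp only [IsDiag, laceTime_relabel, laceStart_relabel, injOn_pos_relabel_iff]

end Relabel

/-! ### The set of coordinates used by a walk -/

section Used

variable {d D : ℕ}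

/-- The set of coordinates (dimensions) in which the walk `σ` takes at least one step.
[cite: Graham2010, Section 3] -/
def usedDirs {n : ℕ} (σ : StepSeq d n) : Finset (Fin d) :=
  Finset.univ.image fun i => (σ i).1

/-- Each step's coordinate is used. [folklore] -/
theorem fst_mem_usedDirs {n : ℕ} (σ : StepSeq d n) (i : Fin n) : (σ i).1 ∈ usedDirs σ :=
  Finset.mem_image_of_mem _ (Finset.mem_univ i)

/-- Membership in `usedDirs`. [folklore] -/
theorem mem_usedDirs {n : ℕ} (σ : StepSeq d n) (j : Fin d) : j ∈ usedDirs σ ↔ ∃ i, (σ i).1 = j := by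
  simp [usedDirs]

/-- An `n`-step walk uses at most `n` coordinates. [folklore] -/
theorem card_usedDirs_le {n : ℕ} (σ : StepSeq d n) : (usedDirs σ).card ≤ n :=
  Finset.card_image_le.trans (by simp)

/-- `usedDirs (relabel ι σ) = ι(usedDirs σ)`. [folklore] -/
theorem usedDirs_relabel (ι : Fin D ↪ Fin d) {n : ℕ} (σ : StepSeq D n) :
    usedDirs (relabel ι σ) = (usedDirs σ).map ι := by
  ext j
  rw [mem_usedDirs, Finset.mem_map]
  constructor
  · rintro ⟨i, hi⟩
    exact ⟨(σ i).1, fst_mem_usedDirs σ i, hi⟩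
  · rintro ⟨k, hk, rfl⟩
    obtain ⟨i, hi⟩ := (mem_usedDirs σ k).1 hk
    exact ⟨i, by simp only [relabel]; rw [hi]⟩

end Used

/-! ### The dimension decomposition of a coordinate-symmetric count -/

section Decomposition

variable {n : ℕ}

/-- `g_P(D)`: the number of `n`-step walks of `ℤ^D` with property `P` using ALL `D` coordinates
(Graham's `f(a,N,D)` counts the symmetry classes of these). [cite: Graham2010, Section 3] -/
def dimCount (n : ℕ) (P : ∀ d : ℕ, StepSeq d n → Prop) [∀ d, DecidablePred (P d)] (D : ℕ) : ℕ :=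
  (Finset.univ.filter fun τ : StepSeq D n => P D τ ∧ usedDirs τ = Finset.univ).card

/-- `g_P(D) = 0` for `D > n` (an `n`-step walk uses at most `n` coordinates). [folklore] -/
theorem dimCount_eq_zero_of_lt (P : ∀ d : ℕ, StepSeq d n → Prop) [∀ d, DecidablePred (P d)] {D : ℕ}
    (hD : n < D) : dimCount n P D = 0 := by
  rw [dimCount, Finset.card_eq_zero, Finset.filter_eq_empty_iff]
  rintro τ - ⟨-, hτ⟩
  have := card_usedDirs_le τ
  rw [hτ, Finset.card_univ, Fintype.card_fin] at this
  omega

/-- The fibre over a coordinate set `S`, `|S| = D`: relabelling along the increasing enumeration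
of `S` is a bijection from the walks of `ℤ^D` with `P` using all coordinates onto the walks of
`ℤ^d` with `P` using exactly `S`. [cite: Graham2010, Section 3] -/
theorem card_filter_usedDirs_eq (P : ∀ d : ℕ, StepSeq d n → Prop) [∀ d, DecidablePred (P d)]
    (hP : ∀ (D d : ℕ) (ι : Fin D ↪ Fin d) (σ : StepSeq D n), P d (relabel ι σ) ↔ P D σ)
    {d : ℕ} (S : Finset (Fin d)) :
    (Finset.univ.filter fun σ : StepSeq d n => P d σ ∧ usedDirs σ = S).card = dimCount n P S.card := by
  classical
  set D := S.card with hD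
  set e : Fin D ≃o S := S.orderIsoOfFin rfl with he
  set ι : Fin D ↪ Fin d := (S.orderEmbOfFin rfl).toEmbedding with hι
  have hιe : ∀ k, ι k = (e k : Fin d) := fun k => rfl
  have hιmem : ∀ k, ι k ∈ S := fun k => S.orderEmbOfFin_mem rfl k
  have hmapuniv : (Finset.univ : Finset (Fin D)).map ι = S := by
    apply Finset.coe_injective
    rw [Finset.coe_map, Finset.coe_univ, Set.image_univ]
    exact S.range_orderEmbOfFin rfl
  rw [dimCount]
  -- the inverse relabelling on the fibre
  have memS : ∀ σ : StepSeq d n, σ ∈ (Finset.univ.filter fun σ : StepSeq d n => P d σ ∧ usedDirs σ = S) →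
      ∀ i, (σ i).1 ∈ S := by
    intro σ hσ i
    have h := (Finset.mem_filter.1 hσ).2.2
    rw [← h]
    exact fst_mem_usedDirs σ i
  set j : ∀ σ : StepSeq d n, σ ∈ (Finset.univ.filter fun σ : StepSeq d n => P d σ ∧ usedDirs σ = S) →
      StepSeq D n := fun σ hσ i => (e.symm ⟨(σ i).1, memS σ hσ i⟩, (σ i).2) with hj
  have hre : ∀ σ hσ, relabel ι (j σ hσ) = σ := by
    intro σ hσ
    funext i
    simp only [relabel, hj]
    refine Prod.ext ?_ rfl
    change ((e (e.symm ⟨(σ i).1, memS σ hσ i⟩) : S) : Fin d) = (σ i).1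
    rw [OrderIso.apply_symm_apply]
  symm
  refine Finset.card_bij' (fun τ _ => relabel ι τ) j ?hi ?hj ?left ?right
  case hi =>
    intro τ hτ
    rw [Finset.mem_filter] at hτ ⊢
    refine ⟨Finset.mem_univ _, (hP D d ι τ).2 hτ.2.1, ?_⟩
    rw [usedDirs_relabel, hτ.2.2, hmapuniv]
  case hj =>
    intro σ hσ
    have hσ' := (Finset.mem_filter.1 hσ).2
    rw [Finset.mem_filter]
    refine ⟨Finset.mem_univ _, ?_, ?_⟩
    · have := (hP D d ι (j σ hσ)).1
      rw [hre σ hσ] at this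
      exact this hσ'.1
    · apply Finset.map_injective ι
      rw [← usedDirs_relabel, hre σ hσ, hσ'.2, hmapuniv]
  case left =>
    intro τ hτ
    funext i
    simp only [relabel, hj]
    refine Prod.ext ?_ rfl
    apply e.injective
    rw [OrderIso.apply_symm_apply]
    exact Subtype.ext rfl
  case right =>
    intro σ hσ
    exact hre σ hσ

/-- **The dimension decomposition.** For a property `P` of `n`-step walks invariant under
relabelling of the coordinates, `#{σ : StepSeq d n | P σ} = Σ_{D=0}^{n} C(d,D) · g_P(D)`:
a polynomial in `d` with `d`-independent coefficients (Graham: "we can write the number of …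
lace graphs of length `a` and type `N` in `ℤ^d` as a polynomial in powers of `s⁻¹ = 2d`").
[cite: Graham2010, Section 3] -/
theorem card_filter_eq_sum_choose_mul (P : ∀ d : ℕ, StepSeq d n → Prop) [∀ d, DecidablePred (P d)]
    (hP : ∀ (D d : ℕ) (ι : Fin D ↪ Fin d) (σ : StepSeq D n), P d (relabel ι σ) ↔ P D σ) (d : ℕ) :
    (Finset.univ.filter fun σ : StepSeq d n => P d σ).card =
      ∑ D ∈ Finset.range (n + 1), d.choose D * dimCount n P D := by
  classical
  -- fibre over the set of used coordinates
  have h1 : (Finset.univ.filter fun σ : StepSeq d n => P d σ).card =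
      ∑ S ∈ (Finset.univ : Finset (Fin d)).powerset,
        ((Finset.univ.filter fun σ : StepSeq d n => P d σ).filter fun σ => usedDirs σ = S).card :=
    Finset.card_eq_sum_card_fiberwise fun σ _ => Finset.mem_powerset.2 (Finset.subset_univ _)
  have h2 : ∀ S : Finset (Fin d),
      ((Finset.univ.filter fun σ : StepSeq d n => P d σ).filter fun σ => usedDirs σ = S).card =
        dimCount n P S.card := by
    intro S
    rw [Finset.filter_filter]
    exact card_filter_usedDirs_eq P hP S
  simp_rw [h1, h2]
  -- group the coordinate sets by cardinality
  rw [Finset.powerset_card_disjiUnion, Finset.sum_disjiUnion, Finset.card_univ, Fintype.card_fin]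
  have h3 : ∀ D : ℕ, ∑ S ∈ Finset.powersetCard D (Finset.univ : Finset (Fin d)), dimCount n P S.card =
      d.choose D * dimCount n P D := by
    intro D
    rw [Finset.sum_congr rfl fun S hS => by rw [(Finset.mem_powersetCard.1 hS).2], Finset.sum_const,
      Finset.card_powersetCard, Finset.card_univ, Fintype.card_fin, smul_eq_mul]
  simp_rw [h3]
  -- both ranges may be replaced by `range (d + n + 1)`: the extra terms vanish
  have hbig : ∀ N : ℕ, d ≤ N → n ≤ N → ∀ K : ℕ, (K = d ∨ K = n) →
      ∑ D ∈ Finset.range (K + 1), d.choose D * dimCount n P D =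
        ∑ D ∈ Finset.range (N + 1), d.choose D * dimCount n P D := by
    intro N hdN hnN K hK
    have hKN : K ≤ N := by rcases hK with rfl | rfl <;> assumption
    refine Finset.sum_subset (Finset.range_subset_range.2 (by omega)) fun D hD hD' => ?_
    rw [Finset.mem_range] at hD hD'
    rcases hK with rfl | rfl
    · rw [Nat.choose_eq_zero_of_lt (by omega), zero_mul]
    · rw [dimCount_eq_zero_of_lt P (by omega), mul_zero]
  rw [hbig (d + n) (by omega) (by omega) d (Or.inl rfl), hbig (d + n) (by omega) (by omega) n (Or.inr rfl)]

end Decomposition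

/-! ### Lace graphs of length `a` and order `M + 1` -/

section Diagrams

variable {d : ℕ}

open Classical in
/-- The total number `Σ_x π_a^{(M+1)}(x)` of `a`-step lace graphs (diagrams of §3.1) of order
`M + 1` in `ℤ^d`: step sequences `σ` with `IsDiag σ M` and `T_M = a`.
[cite: Slade2006LaceExpansion, §3.1, eq. (3.6)] -/
def diagTotal (d a M : ℕ) : ℕ :=
  (Finset.univ.filter fun σ : StepSeq d a => IsDiag σ M ∧ laceTime σ M = a).card

/-- `diagTotal d a M = Σ_{x ∈ box} π_a^{(M+1)}(x)`. [cite: Slade2006LaceExpansion, §3.1, eq. (3.6)] -/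
theorem diagTotal_eq_sum_piN (d a M : ℕ) : diagTotal d a M = ∑ x ∈ box d a, piN d a M x := by
  classical
  unfold diagTotal piN diagSet
  rw [Finset.card_eq_sum_card_fiberwise (f := fun σ : StepSeq d a => pos σ a) (t := box d a)
    fun σ _ => pos_mem_box σ a]
  refine Finset.sum_congr rfl fun x _ => ?_
  rw [Finset.filter_filter]

open Classical in
/-- `g(a, M+1, D)`: the number of `a`-step lace graphs of order `M + 1` in `ℤ^D` using all `D`
coordinates (the labelled version of Graham's `f_τ(a,N,D)`, `τ = ∞`, `N = M + 1`).
[cite: Graham2010, Section 3] -/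
def diagDim (a M D : ℕ) : ℕ :=
  dimCount a (fun D (σ : StepSeq D a) => IsDiag σ M ∧ laceTime σ M = a) D

/-- **Lace-graph counts are polynomials in the dimension**:
`Σ_x π_a^{(M+1)}(x) = Σ_{D=0}^{a} C(d,D) · g(a, M+1, D)`. [cite: Graham2010, Section 3] -/
theorem diagTotal_eq_sum_choose_mul (d a M : ℕ) :
    diagTotal d a M = ∑ D ∈ Finset.range (a + 1), d.choose D * diagDim a M D := by
  classical
  unfold diagTotal diagDim
  convert card_filter_eq_sum_choose_mul (n := a)
    (fun D (σ : StepSeq D a) => IsDiag σ M ∧ laceTime σ M = a) ?_ d using 3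
  intro D d ι σ
  rw [isDiag_relabel_iff, laceTime_relabel]

/-- `g(a, M+1, D) ≤ (2D)^a` (at most the number of all `a`-step walks of `ℤ^D`; Graham: "The
number of lace graphs of length `a` in `ℤ^D` is at most `(2D)^a`").
[cite: Graham2010, Section 4, proof of Lemma 4] -/
theorem diagDim_le (a M D : ℕ) : diagDim a M D ≤ (2 * D) ^ a := by
  classical
  unfold diagDim dimCount
  exact (Finset.card_filter_le _ _).trans (by rw [Finset.card_univ, card_stepSeq])

/-! #### Every step of a lace graph lies on a closed subwalk, so each used coordinate is used twice -/

/-- On a closed subwalk `ω(u) = ω(v)`, `u ≤ v ≤ n`, no coordinate is stepped in exactly once: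
if step `i ∈ [u,v)` is in coordinate `j` then another step `i' ∈ [u,v)`, `i' ≠ i`, is too.
[folklore] -/
theorem exists_other_step_of_pos_eq {n : ℕ} (σ : StepSeq d n) {u v : ℕ} (huv : u ≤ v)
    (hpos : pos σ u = pos σ v) (i : Fin n) (hui : u ≤ i) (hiv : (i : ℕ) < v) :
    ∃ i' : Fin n, i' ≠ i ∧ u ≤ i' ∧ (i' : ℕ) < v ∧ (σ i').1 = (σ i).1 := by
  classical
  by_contra hcon
  have hcon' : ∀ i' : Fin n, i' ≠ i → u ≤ (i' : ℕ) → (i' : ℕ) < v → (σ i').1 ≠ (σ i).1 :=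
    fun i' h1 h2 h3 h4 => hcon ⟨i', h1, h2, h3, h4⟩
  -- the `(σ i).1`-coordinate of `ω(v) - ω(u)` is `± 1`
  set j := (σ i).1 with hj
  have hdiff : pos σ v - pos σ u = ∑ i' : Fin n, if u ≤ (i' : ℕ) ∧ (i' : ℕ) < v then stepVec (σ i') else 0 := by
    unfold pos
    rw [← Finset.sum_sub_distrib]
    refine Finset.sum_congr rfl fun i' _ => ?_
    by_cases h1 : (i' : ℕ) < u
    · have h2 : (i' : ℕ) < v := lt_of_lt_of_le h1 huv
      simp [h1, h2]
    · by_cases h2 : (i' : ℕ) < v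
      · simp [h1, h2, show u ≤ (i' : ℕ) from not_lt.1 h1]
      · simp [h1, h2]
  have hzero : (∑ i' : Fin n, if u ≤ (i' : ℕ) ∧ (i' : ℕ) < v then stepVec (σ i') else 0) j = 0 := by
    rw [← hdiff, hpos, sub_self]; rfl
  rw [Finset.sum_apply, Finset.sum_eq_single i] at hzero
  · rw [if_pos ⟨hui, hiv⟩, stepVec_apply] at hzero
    simp only [hj] at hzero
    split_ifs at hzero <;> simp at hzero
  · intro i' _ hi'
    by_cases hr : u ≤ (i' : ℕ) ∧ (i' : ℕ) < v
    · rw [if_pos hr, stepVec_apply, if_neg]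
      exact fun h => hcon' i' hi' hr.1 hr.2 (by rw [hj]; exact h.symm)
    · rw [if_neg hr]; rfl
  · simp

/-- If `T_M = a` (all `a` steps belong to the pieces `ρ_0, …, ρ_M`), every step `i < a` lies on a closed subwalk
`[u, v]`, `ω(u) = ω(v)`, `v ≤ a`: the piece `ρ_k` containing it ends, at `T_k`, on a site
`ω(t')` of `ρ_{k-1}` (or at `0` for `k = 0`). [cite: Slade2006LaceExpansion, §3.1] -/
theorem exists_closed_subwalk {a M : ℕ} {σ : StepSeq d a} (hT : laceTime σ M = a) (i : Fin a) : ∃ u v : ℕ, u ≤ i ∧ (i : ℕ) < v ∧ v ≤ a ∧ pos σ u = pos σ v := by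
  -- the first `k` with `i < T_k` (exists since `T_M = a > i`)
  have hiM : (i : ℕ) < laceTime σ M := by rw [hT]; exact i.isLt
  have hex : ∃ k, (i : ℕ) < laceTime σ k := ⟨M, hiM⟩
  classical
  have hik : (i : ℕ) < laceTime σ (Nat.find hex) := Nat.find_spec hex
  have hmin : ∀ k', k' < Nat.find hex → ¬ ((i : ℕ) < laceTime σ k') := fun k' hk' => Nat.find_min hex hk'
  have hkM : Nat.find hex ≤ M := Nat.find_min' hex hiM
  generalize Nat.find hex = k at hik hmin hkM
  have hTk : laceTime σ k ≤ a := by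
    have := laceTime_mono σ hkM
    rw [hT] at this
    exact this
  -- `laceStart σ k ≤ i`
  have hstart : laceStart σ k ≤ i := by
    rcases k with _ | k'
    · rw [laceStart_zero]; exact Nat.zero_le _
    · rw [laceStart_succ]
      by_contra hlt
      exact hmin k' (Nat.lt_succ_self k') (not_le.1 hlt)
  -- `ω(T_k) ∈ pieceSet σ k = ω '' [prevLo, laceStart]`
  obtain ⟨-, hmem⟩ := laceTime_spec hTk
  obtain ⟨t', ht', hpos'⟩ := hmem
  refine ⟨t', laceTime σ k, ?_, hik, hTk, hpos'.symm ▸ rfl⟩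
  exact (Set.mem_Icc.1 ht').2.trans hstart

/-- **Dimensionality `D` needs length `≥ 2D`**: a lace graph using all `D` coordinates of `ℤ^D`
has length `a ≥ 2D`, i.e. `g(a, M+1, D) = 0` for `a < 2D` (Graham: "Lace graphs with
dimensionality `D` have length at least `2D`"). [cite: Graham2010, Section 3] -/
theorem diagDim_eq_zero_of_lt {a M D : ℕ} (h : a < 2 * D) : diagDim a M D = 0 := by
  classical
  unfold diagDim dimCount
  rw [Finset.card_eq_zero, Finset.filter_eq_empty_iff]
  rintro σ - ⟨⟨-, hT⟩, hused⟩
  -- every fibre of `i ↦ (σ i).1` has at least two elements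
  have htwo : ∀ j : Fin D, 2 ≤ (Finset.univ.filter fun i : Fin a => (σ i).1 = j).card := by
    intro j
    have hj : j ∈ usedDirs σ := by rw [hused]; exact Finset.mem_univ j
    obtain ⟨i, hi⟩ := (mem_usedDirs σ j).1 hj
    obtain ⟨u, v, hui, hiv, hva, hpos⟩ := exists_closed_subwalk hT i
    obtain ⟨i', hne, -, -, hi'⟩ := exists_other_step_of_pos_eq σ (by omega) hpos i hui hiv
    rw [hi] at hi'
    have hsub : ({i, i'} : Finset (Fin a)) ⊆ Finset.univ.filter fun i : Fin a => (σ i).1 = j := by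
      intro x hx
      rw [Finset.mem_insert, Finset.mem_singleton] at hx
      rw [Finset.mem_filter]
      rcases hx with rfl | rfl
      · exact ⟨Finset.mem_univ _, hi⟩
      · exact ⟨Finset.mem_univ _, hi'⟩
    calc 2 = ({i, i'} : Finset (Fin a)).card := by rw [Finset.card_pair hne.symm]
      _ ≤ _ := Finset.card_le_card hsub
  -- sum over the fibres: `a = Σ_j #fibre(j) ≥ 2D`
  have hsum : (Finset.univ : Finset (Fin a)).card =
      ∑ j : Fin D, (Finset.univ.filter fun i : Fin a => (σ i).1 = j).card :=
    Finset.card_eq_sum_card_fiberwise fun i _ => Finset.mem_univ _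
  have : 2 * D ≤ a := by
    calc 2 * D = ∑ _j : Fin D, 2 := by simp [mul_comm]
      _ ≤ ∑ j : Fin D, (Finset.univ.filter fun i : Fin a => (σ i).1 = j).card := Finset.sum_le_sum fun j _ => htwo j
      _ = a := by rw [← hsum, Finset.card_univ, Fintype.card_fin]
  omega

/-- There are no lace graphs using no coordinate (`a ≥ 1` forces a used coordinate; for `a = 0`
there is no lace graph at all, `T_M ≥ 2`). [folklore] -/
theorem diagDim_zero_right (a M : ℕ) : diagDim a M 0 = 0 := by
  classical
  unfold diagDim dimCount
  rw [Finset.card_eq_zero, Finset.filter_eq_empty_iff]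
  rintro σ - ⟨⟨hdiag, hT⟩, -⟩
  have h2 : M + 2 ≤ laceTime σ M := add_two_le_laceTime hdiag.1
  rw [hT] at h2
  -- `a ≥ 2` steps in `ℤ^0`: impossible, there are no directions
  have i : Fin a := ⟨0, by omega⟩
  exact Fin.elim0 (σ i).1

/-- The decomposition with Graham's summation range `D = 1, …, ⌊a/2⌋`:
`Σ_x π_a^{(M+1)}(x) = Σ_{D=1}^{⌊a/2⌋} C(d,D) g(a, M+1, D)`. [cite: Graham2010, Section 3] -/
theorem diagTotal_eq_sum_Icc (d a M : ℕ) :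
    diagTotal d a M = ∑ D ∈ Finset.Icc 1 (a / 2), d.choose D * diagDim a M D := by
  rw [diagTotal_eq_sum_choose_mul]
  symm
  refine Finset.sum_subset (fun D hD => ?_) fun D hD hD' => ?_
  · rw [Finset.mem_Icc] at hD
    rw [Finset.mem_range]
    omega
  · rw [Finset.mem_range] at hD
    rw [Finset.mem_Icc, not_and_or, not_le, not_le] at hD'
    rcases hD' with h0 | hbig
    · have : D = 0 := by omega
      rw [this, diagDim_zero_right, mul_zero]
    · rw [diagDim_eq_zero_of_lt (by omega), mul_zero]

end Diagrams

end Literature.Probability.RandomPlanarGeometry.SAW.Zd.Graham2010
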